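import Literature.NumberTheory.EllipticCurves.SteinWuthrich2013.SplitLogUniformizationProofs
import Literature.NumberTheory.EllipticCurves.CanonicalPAdicHeightIntegralityProofs
import HarnessLib

/-!
# `exp_p ∘ log_p = id` on the one-units of `ℚ_p` (`p` odd) and `cosh(log_p u) = (u + u⁻¹)/2`
# (Gouvêa 1993, Prop. 5.7.7–5.7.8; proofs only)

Topic `Literature/NumberTheory/EllipticCurves` (cluster `SteinWuthrich2013`, because of
`coshOfSq`); proof file (theorems only, nothing asserted, no definition). Cell `bsd-eis`, seat
`bsd-eis-k5-c4` g3: input (T2e) of the discharge of the named fact `exists_isSplitMultCanonical`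
(`MultiplicativeHeightExistence.lean`; crux 4 `BSDpOnCellC` of route `EisensteinPrimes`,
stmt-BirchSwinnertonDyer-19034, `stub_publishedFacts` conjunct `hHs`) — the identity
`coshOfSq ((log_p υ)²) = (υ + υ⁻¹)/2` for one-units `υ`, which turns the hypothesis `hυσ` of
`tateSigma_theta_of_uniformization` into `tateSigmaSq_cosh_eq` (`TateSigmaThetaProofs.lean`) once
`logUnitParamSq = (log_p υ)²` (`SplitLogUniformizationProofs.lean`).

With Mathlib's exponential `NormedSpace.exp` on `ℚ_p` (the sum of `Σ xⁿ/n!`):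

* `expSeries_radius_ge` — for `p ≠ 2` the exponential series of `ℚ_p` has radius `≥ (√p)⁻¹`
  (Gouvêa Lemma 5.7.4 / Prop. 5.7.6: `|xⁿ/n!| ≤ |x|ⁿ p^{n/(p−1)}`; we use Legendre's
  `(p−1)v_p(n!) < n`, Mathlib `sub_one_mul_padicValNat_factorial_lt_of_ne_zero`), so one-units'
  logarithms (`‖·‖ ≤ p⁻¹`) lie in the ball of convergence: `exp_add` (Prop. 5.7.7, Mathlib
  `NormedSpace.exp_add_of_mem_ball`) and `HasSum (xⁿ/n!) (exp x)` apply;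
* `norm_exp_sub_one_sub_le`, `norm_exp_sub_one_le` — `‖exp x − 1 − x‖ ≤ ‖x‖²`,
  `‖exp x − 1‖ ≤ ‖x‖` for `‖x‖ ≤ p⁻¹`, `p ≠ 2`;
* `exp_padicLog_eq_self` — **Prop. 5.7.8: `exp_p(log_p υ) = υ` for `‖υ − 1‖ ≤ p⁻¹`, `p ≠ 2`**, by
  MULTIPLICATIVE RIGIDITY (`LocalFields.eq_one_of_mul_hom_of_norm_sub_one_le_sq`):
  `R(υ) = exp(log υ)/υ` is multiplicative on one-units and `R(1+t) = 1 + O(t²)`;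
* `coshOfSq_padicLog_sq` — **`coshOfSq ((log_p υ)²) = (υ + υ⁻¹)/2`**: split `exp(±L)` into even and
  odd parts (Mathlib `HasSum.even_add_odd`).

## Sources

* F. Q. Gouvêa, *p-adic Numbers: An Introduction* (1993), §5.7: Lemma 5.7.4, Prop. 5.7.6,
  Prop. 5.7.7, Prop. 5.7.8 (held copy `book:gouvea1993-p-adic-numbers`, PDF pp. 120–124).
  [Gouvea1993PadicNumbers]
* W. Stein, C. Wuthrich, Math. Comp. 82 (2013), §4.2 (`u = exp_p log_p u` on `1 + pℤ_p`,
  `(u + u⁻¹)/2` in `σ_p(u)²`). [SteinWuthrich2013]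
-/

noncomputable section

open scoped Classical NNReal ENNReal Nat

open Filter Topology Literature.NumberTheory.EllipticCurves Literature.NumberTheory.LocalFields

namespace Literature.NumberTheory.EllipticCurves.SteinWuthrich2013

variable {p : ℕ} [hp : Fact p.Prime]

/-! ### The radius of the `p`-adic exponential series -/

/-- `2 v_p(n!) ≤ n` for `p ≠ 2` (Legendre: `(p−1)v_p(n!) < n` for `n ≠ 0`).
[Gouvêa 1993, Lemma 5.7.4] [cite: Gouvea1993PadicNumbers, §5.7 Lemma 5.7.4 (PDF p. 121)] -/
theorem two_mul_padicValNat_factorial_le (hp2 : p ≠ 2) (n : ℕ) : 2 * padicValNat p n ! ≤ n := by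
  rcases Nat.eq_zero_or_pos n with rfl | hn
  · simp
  have h := sub_one_mul_padicValNat_factorial_lt_of_ne_zero p hn.ne'
  have hp3 : 3 ≤ p := by
    have := hp.out.two_le
    omega
  calc 2 * padicValNat p n ! ≤ (p - 1) * padicValNat p n ! := Nat.mul_le_mul_right _ (by omega)
    _ ≤ n := h.le

/-- `v_p(n!) ≤ n − 2` for `n ≥ 2`, `p ≠ 2`. [Gouvêa 1993, Lemma 5.7.4]
[cite: Gouvea1993PadicNumbers, §5.7 Lemma 5.7.4 (PDF p. 121)] -/
theorem padicValNat_factorial_le_sub_two (hp2 : p ≠ 2) {n : ℕ} (hn : 2 ≤ n) :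
    padicValNat p n ! ≤ n - 2 := by
  have h := sub_one_mul_padicValNat_factorial_lt_of_ne_zero p (show n ≠ 0 by omega)
  have hp3 : 3 ≤ p := by
    have := hp.out.two_le
    omega
  have h2 : 2 * padicValNat p n ! < n :=
    lt_of_le_of_lt (Nat.mul_le_mul_right _ (by omega)) h
  omega

/-- `‖(n!)⁻¹‖_p = p^{v_p(n!)}`. [Gouvêa 1993, §5.7] [cite: Gouvea1993PadicNumbers, §5.7 Lemma 5.7.4 (PDF p. 121)] -/
theorem norm_inv_factorial (n : ℕ) : ‖((n ! : ℕ) : ℚ_[p])⁻¹‖ = (p : ℝ) ^ (padicValNat p n ! : ℤ) := by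
  have hne : ((n ! : ℕ) : ℚ_[p]) ≠ 0 := by exact_mod_cast (Nat.factorial_pos n).ne'
  rw [norm_inv, Padic.norm_eq_zpow_neg_valuation hne, Padic.valuation_natCast, zpow_neg, inv_inv]

/-- **The exponential series of `ℚ_p` converges on `‖x‖ < (√p)⁻¹`** (`p ≠ 2`): its radius is
`≥ (√p)⁻¹`, since `‖xⁿ/n!‖ ≤ ((√p)⁻¹)ⁿ p^{v_p(n!)} ≤ 1` by `2v_p(n!) ≤ n` (Gouvêa Prop. 5.7.6 gives the
exact radius `p^{−1/(p−1)} ≥ (√p)⁻¹`). [cite: Gouvea1993PadicNumbers, §5.7 Prop. 5.7.6 (PDF p. 122)] -/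
theorem expSeries_radius_ge (hp2 : p ≠ 2) :
    (((Real.toNNReal (Real.sqrt (p : ℝ)))⁻¹ : ℝ≥0) : ℝ≥0∞) ≤
      (NormedSpace.expSeries ℚ_[p] ℚ_[p]).radius := by
  have hp0 : (0 : ℝ) < p := by exact_mod_cast hp.out.pos
  have hsq : 0 < Real.sqrt p := Real.sqrt_pos.mpr hp0
  refine FormalMultilinearSeries.le_radius_of_bound _ 1 fun n => ?_
  have hcoe : (((Real.toNNReal (Real.sqrt (p : ℝ)))⁻¹ : ℝ≥0) : ℝ) = (Real.sqrt p)⁻¹ := by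
    rw [NNReal.coe_inv, Real.coe_toNNReal _ hsq.le]
  rw [hcoe]
  have hnorm : ‖NormedSpace.expSeries ℚ_[p] ℚ_[p] n‖ ≤ (p : ℝ) ^ (padicValNat p n ! : ℤ) := by
    unfold NormedSpace.expSeries
    rw [norm_smul, ContinuousMultilinearMap.norm_mkPiAlgebraFin, mul_one, ← norm_inv_factorial n]
  calc ‖NormedSpace.expSeries ℚ_[p] ℚ_[p] n‖ * ((Real.sqrt p)⁻¹) ^ n
      ≤ (p : ℝ) ^ (padicValNat p n ! : ℤ) * ((Real.sqrt p)⁻¹) ^ n :=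
        mul_le_mul_of_nonneg_right hnorm (pow_nonneg (inv_nonneg.mpr hsq.le) n)
    _ ≤ 1 := by
        -- `p^{v} ≤ (√p)^n` since `p^{2v} ≤ p^n`
        rw [inv_pow, ← div_eq_mul_inv, div_le_one (pow_pos hsq n), zpow_natCast]
        have h2v := two_mul_padicValNat_factorial_le hp2 n
        calc (p : ℝ) ^ padicValNat p n ! = (Real.sqrt p) ^ (2 * padicValNat p n !) := by
              rw [pow_mul, Real.sq_sqrt hp0.le]
          _ ≤ (Real.sqrt p) ^ n :=
              pow_le_pow_right₀ (Real.one_le_sqrt.mpr (by exact_mod_cast hp.out.one_lt.le)) h2v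

/-- A one-unit's worth: `‖x‖ ≤ p⁻¹` puts `x` in the ball of convergence of `exp_p` (`p ≠ 2`).
[cite: Gouvea1993PadicNumbers, §5.7 Prop. 5.7.6 (PDF p. 122)] -/
theorem mem_ball_expSeries (hp2 : p ≠ 2) {x : ℚ_[p]} (hx : ‖x‖ ≤ (p : ℝ)⁻¹) :
    x ∈ Metric.eball (0 : ℚ_[p]) (NormedSpace.expSeries ℚ_[p] ℚ_[p]).radius := by
  have hp0 : (0 : ℝ) < p := by exact_mod_cast hp.out.pos
  have hp1 : (1 : ℝ) < p := by exact_mod_cast hp.out.one_lt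
  have hsq : 0 < Real.sqrt p := Real.sqrt_pos.mpr hp0
  have hlt : ‖x‖ < (Real.sqrt p)⁻¹ := by
    refine hx.trans_lt ?_
    rw [inv_lt_inv₀ hp0 hsq]
    calc Real.sqrt p < Real.sqrt p * Real.sqrt p := by
          have h1 : 1 < Real.sqrt p := by
            rw [show (1 : ℝ) = Real.sqrt 1 from Real.sqrt_one.symm]
            exact Real.sqrt_lt_sqrt zero_le_one hp1
          exact lt_mul_of_one_lt_right hsq h1
      _ = p := Real.mul_self_sqrt hp0.le
  rw [Metric.mem_eball, edist_zero_right, enorm_eq_nnnorm]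
  have : (‖x‖₊ : ℝ≥0) < (Real.toNNReal (Real.sqrt (p : ℝ)))⁻¹ := by
    rw [← NNReal.coe_lt_coe, NNReal.coe_inv, Real.coe_toNNReal _ hsq.le, coe_nnnorm]
    exact hlt
  exact lt_of_lt_of_le (ENNReal.coe_lt_coe.mpr this) (expSeries_radius_ge hp2)

/-- **`exp_p(x + y) = exp_p(x) exp_p(y)`** for `‖x‖, ‖y‖ ≤ p⁻¹`, `p ≠ 2` (Gouvêa Prop. 5.7.7; Mathlib
`NormedSpace.exp_add_of_mem_ball`). [cite: Gouvea1993PadicNumbers, §5.7 Prop. 5.7.7 (PDF p. 123)] -/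
theorem exp_add_of_norm_le (hp2 : p ≠ 2) {x y : ℚ_[p]} (hx : ‖x‖ ≤ (p : ℝ)⁻¹)
    (hy : ‖y‖ ≤ (p : ℝ)⁻¹) :
    NormedSpace.exp (x + y) = NormedSpace.exp x * NormedSpace.exp y :=
  NormedSpace.exp_add_of_mem_ball (𝕂 := ℚ_[p]) (mem_ball_expSeries hp2 hx) (mem_ball_expSeries hp2 hy)

/-- `HasSum (xⁿ/n!) (exp_p x)` for `‖x‖ ≤ p⁻¹`, `p ≠ 2`. [cite: Gouvea1993PadicNumbers, §5.7 Prop. 5.7.6 (PDF p. 122)] -/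
theorem hasSum_exp_of_norm_le (hp2 : p ≠ 2) {x : ℚ_[p]} (hx : ‖x‖ ≤ (p : ℝ)⁻¹) :
    HasSum (fun n : ℕ => ((n ! : ℕ) : ℚ_[p])⁻¹ * x ^ n) (NormedSpace.exp x) := by
  have h := NormedSpace.expSeries_hasSum_exp_of_mem_ball' (𝕂 := ℚ_[p]) x (mem_ball_expSeries hp2 hx)
  refine h.congr_fun fun n => ?_
  rw [smul_eq_mul]

/-- The general term: `‖xⁿ/n!‖ ≤ ‖x‖²` for `n ≥ 2` and `‖xⁿ/n!‖ ≤ ‖x‖` for `n ≥ 1`, when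
`‖x‖ ≤ p⁻¹`, `p ≠ 2` (`v_p(n!) ≤ n − 2`). [cite: Gouvea1993PadicNumbers, §5.7 Lemma 5.7.4 (PDF p. 121)] -/
theorem norm_exp_term_le (hp2 : p ≠ 2) {x : ℚ_[p]} (hx : ‖x‖ ≤ (p : ℝ)⁻¹) {n : ℕ} (hn : 2 ≤ n) :
    ‖((n ! : ℕ) : ℚ_[p])⁻¹ * x ^ n‖ ≤ ‖x‖ ^ 2 := by
  have hp0 : (0 : ℝ) < p := by exact_mod_cast hp.out.pos
  have hp1 : (1 : ℝ) ≤ p := by exact_mod_cast hp.out.one_lt.le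
  rw [norm_mul, norm_pow, norm_inv_factorial, zpow_natCast]
  have hv := padicValNat_factorial_le_sub_two hp2 hn
  obtain ⟨m, rfl⟩ : ∃ m, n = m + 2 := ⟨n - 2, by omega⟩
  have hv' : padicValNat p (m + 2)! ≤ m := by omega
  calc (p : ℝ) ^ padicValNat p (m + 2)! * ‖x‖ ^ (m + 2)
      ≤ (p : ℝ) ^ m * ‖x‖ ^ (m + 2) :=
        mul_le_mul_of_nonneg_right (pow_le_pow_right₀ hp1 hv') (pow_nonneg (norm_nonneg _) _)
    _ = ((p : ℝ) * ‖x‖) ^ m * ‖x‖ ^ 2 := by ring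
    _ ≤ 1 * ‖x‖ ^ 2 := by
        refine mul_le_mul_of_nonneg_right (pow_le_one₀ (mul_nonneg hp0.le (norm_nonneg _)) ?_)
          (sq_nonneg _)
        calc (p : ℝ) * ‖x‖ ≤ (p : ℝ) * (p : ℝ)⁻¹ := mul_le_mul_of_nonneg_left hx hp0.le
          _ = 1 := mul_inv_cancel₀ hp0.ne'
    _ = ‖x‖ ^ 2 := one_mul _

/-- **`‖exp_p x − 1 − x‖ ≤ ‖x‖²`** for `‖x‖ ≤ p⁻¹`, `p ≠ 2`. [Gouvêa 1993, §5.7 (Prop. 5.7.8, proof)]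
[cite: Gouvea1993PadicNumbers, §5.7 Prop. 5.7.8 (PDF p. 124)] -/
theorem norm_exp_sub_one_sub_le (hp2 : p ≠ 2) {x : ℚ_[p]} (hx : ‖x‖ ≤ (p : ℝ)⁻¹) :
    ‖NormedSpace.exp x - 1 - x‖ ≤ ‖x‖ ^ 2 := by
  have h := hasSum_exp_of_norm_le hp2 hx
  have hS := h.summable
  have hsplit : NormedSpace.exp x = 1 + x + ∑' n : ℕ, ((((n + 2) ! : ℕ) : ℚ_[p])⁻¹ * x ^ (n + 2)) := by
    rw [← h.tsum_eq, hS.tsum_eq_zero_add, (summable_nat_add_iff 1 |>.mpr hS).tsum_eq_zero_add]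
    simp only [Nat.factorial_zero, Nat.cast_one, inv_one, pow_zero, mul_one, zero_add,
      Nat.factorial_one, pow_one, one_mul]
    rw [← add_assoc]
  rw [hsplit, show (1 : ℚ_[p]) + x + _ - 1 - x = ∑' n : ℕ, ((((n + 2) ! : ℕ) : ℚ_[p])⁻¹ * x ^ (n + 2))
    by ring]
  exact IsUltrametricDist.norm_tsum_le_of_forall_le_of_nonneg (sq_nonneg _)
    fun n => norm_exp_term_le hp2 hx (by omega)

/-- **`‖exp_p x − 1‖ ≤ ‖x‖`** for `‖x‖ ≤ p⁻¹`, `p ≠ 2` ("`exp_p(x)` is in the domain of `log_p`",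
Gouvêa Prop. 5.7.8). [cite: Gouvea1993PadicNumbers, §5.7 Prop. 5.7.8 (PDF p. 124)] -/
theorem norm_exp_sub_one_le (hp2 : p ≠ 2) {x : ℚ_[p]} (hx : ‖x‖ ≤ (p : ℝ)⁻¹) :
    ‖NormedSpace.exp x - 1‖ ≤ ‖x‖ := by
  have hp1 : (p : ℝ)⁻¹ ≤ 1 := inv_le_one_of_one_le₀ (by exact_mod_cast hp.out.one_lt.le)
  have e : NormedSpace.exp x - 1 = (NormedSpace.exp x - 1 - x) + x := by ring
  rw [e]
  refine (IsUltrametricDist.norm_add_le_max _ _).trans (max_le ?_ le_rfl)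
  refine (norm_exp_sub_one_sub_le hp2 hx).trans ?_
  calc ‖x‖ ^ 2 = ‖x‖ * ‖x‖ := sq _
    _ ≤ ‖x‖ * 1 := mul_le_mul_of_nonneg_left (hx.trans hp1) (norm_nonneg _)
    _ = ‖x‖ := mul_one _

/-! ### `exp_p ∘ log_p = id` on one-units -/

/-- One-units have norm one. [folklore] -/
private theorem norm_eq_one_of_norm_sub_one_le {v : ℚ_[p]} (hv : ‖v - 1‖ ≤ (p : ℝ)⁻¹) : ‖v‖ = 1 := by
  have hp1 : (p : ℝ)⁻¹ < 1 := inv_lt_one_of_one_lt₀ (by exact_mod_cast hp.out.one_lt)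
  have hv' := hv.trans_lt hp1
  have := IsUltrametricDist.norm_add_eq_max_of_norm_ne_norm (x := v - 1) (y := (1 : ℚ_[p]))
    (by rw [norm_one]; exact hv'.ne)
  rw [sub_add_cancel, norm_one, max_eq_right hv'.le] at this
  exact this

/-- **Gouvêa Prop. 5.7.8 (second half): `exp_p(log_p υ) = υ` for `‖υ − 1‖ ≤ p⁻¹`, `p ≠ 2`.**
Proof by rigidity: `R(υ) = exp_p(log_p υ) · υ⁻¹` is multiplicative on one-units (`log_p` additive —
the tree's `padicLog_mul_holds` —, `exp_p` additive-to-multiplicative on the ball) with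
`‖R(1+t) − 1‖ ≤ 2‖t‖²` (`exp = 1 + x + O(x²)`, `log_p(1+t) = t + O(t²)`), hence `R ≡ 1`
(`LocalFields.eq_one_of_mul_hom_of_norm_sub_one_le_sq`). [Gouvêa 1993, Prop. 5.7.8]
[cite: Gouvea1993PadicNumbers, §5.7 Prop. 5.7.8 (PDF p. 124)] -/
theorem exp_padicLog_eq_self (hp2 : p ≠ 2) {υ : ℚ_[p]} (hυ : ‖υ - 1‖ ≤ (p : ℝ)⁻¹) :
    NormedSpace.exp (padicLog p υ) = υ := by
  have hp0 : (0 : ℝ) < p := by exact_mod_cast hp.out.pos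
  have hpinv1 : (p : ℝ)⁻¹ ≤ 1 := inv_le_one_of_one_le₀ (by exact_mod_cast hp.out.one_lt.le)
  -- facts on the ball
  have hne0 : ∀ {v : ℚ_[p]}, ‖v - 1‖ ≤ (p : ℝ)⁻¹ → v ≠ 0 := fun hv h0 => by
    have := norm_eq_one_of_norm_sub_one_le hv; rw [h0, norm_zero] at this; exact zero_ne_one this
  have hlog : ∀ v : ℚ_[p], ‖padicLog p v‖ ≤ (p : ℝ)⁻¹ := fun v => norm_padicLog_le_inv hp2 v
  set R : ℚ_[p] → ℚ_[p] := fun v => NormedSpace.exp (padicLog p v) * v⁻¹ with hRdef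
  have hmul : ∀ v w : ℚ_[p], ‖v - 1‖ ≤ (p : ℝ)⁻¹ → ‖w - 1‖ ≤ (p : ℝ)⁻¹ → R (v * w) = R v * R w := by
    intro v w hv hw
    simp only [hRdef]
    rw [padicLog_mul_holds p (hne0 hv) (hne0 hw), exp_add_of_norm_le hp2 (hlog v) (hlog w), mul_inv]
    ring
  have hbd : ∀ v : ℚ_[p], ‖v - 1‖ ≤ (p : ℝ)⁻¹ → ‖R v - 1‖ ≤ 2 * ‖v - 1‖ ^ 2 := by
    intro v hv
    have hv1 : ‖v‖ = 1 := norm_eq_one_of_norm_sub_one_le hv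
    have hv0 : v ≠ 0 := hne0 hv
    set t := v - 1 with htdef
    have hvt : v = 1 + t := by rw [htdef]; ring
    set L := padicLog p v with hLdef
    have hLt : ‖L - t‖ ≤ 2 * ‖t‖ ^ 2 := by rw [hLdef, hvt]; exact norm_padicLog_one_add_sub_le hv
    have hL : ‖L‖ ≤ (p : ℝ)⁻¹ := hlog v
    have hE : ‖NormedSpace.exp L - 1 - L‖ ≤ ‖L‖ ^ 2 := norm_exp_sub_one_sub_le hp2 hL
    -- `‖L‖ ≤ ‖t‖`
    have hLn : ‖L‖ ≤ ‖t‖ := by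
      have e : L = (L - t) + t := by ring
      rw [e]
      refine (IsUltrametricDist.norm_add_le_max _ _).trans (max_le (hLt.trans ?_) le_rfl)
      calc 2 * ‖t‖ ^ 2 = (2 * ‖t‖) * ‖t‖ := by ring
        _ ≤ 1 * ‖t‖ := by
            refine mul_le_mul_of_nonneg_right ?_ (norm_nonneg _)
            have hp3 : (3 : ℝ) ≤ p := by
              have := hp.out.two_le
              exact_mod_cast (show 3 ≤ p by omega)
            calc 2 * ‖t‖ ≤ 2 * (p : ℝ)⁻¹ := by gcongr
              _ ≤ 1 := by
                  rw [mul_inv_le_iff₀ hp0]; linarith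
        _ = ‖t‖ := one_mul _
    -- `R v − 1 = (exp L − v)/v`, `‖v‖ = 1`
    have e : R v - 1 = (NormedSpace.exp L - 1 - L + (L - t)) * v⁻¹ := by
      have e1 : NormedSpace.exp L - 1 - L + (L - t) = NormedSpace.exp L - v := by rw [hvt]; ring
      rw [e1]
      show NormedSpace.exp (padicLog p v) * v⁻¹ - 1 = _
      rw [← hLdef]
      field_simp
    rw [e, norm_mul, norm_inv, hv1, inv_one, mul_one]
    refine (IsUltrametricDist.norm_add_le_max _ _).trans (max_le (hE.trans ?_) hLt)
    calc ‖L‖ ^ 2 ≤ ‖t‖ ^ 2 := by gcongr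
      _ ≤ 2 * ‖t‖ ^ 2 := by nlinarith [sq_nonneg ‖t‖]
  have hone : ∀ v : ℚ_[p], ‖v - 1‖ ≤ (p : ℝ)⁻¹ → ‖R v - 1‖ ≤ (p : ℝ)⁻¹ := by
    intro v hv
    refine (hbd v hv).trans ?_
    calc 2 * ‖v - 1‖ ^ 2 ≤ 2 * ((p : ℝ)⁻¹) ^ 2 := by gcongr
      _ = (2 * (p : ℝ)⁻¹) * (p : ℝ)⁻¹ := by ring
      _ ≤ 1 * (p : ℝ)⁻¹ := by
          refine mul_le_mul_of_nonneg_right ?_ (inv_nonneg.mpr hp0.le)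
          have hp3 : (3 : ℝ) ≤ p := by
            have := hp.out.two_le
            exact_mod_cast (show 3 ≤ p by omega)
          rw [mul_inv_le_iff₀ hp0]; linarith
      _ = (p : ℝ)⁻¹ := one_mul _
  have hR := eq_one_of_mul_hom_of_norm_sub_one_le_sq hp2 R 2 hmul hone hbd hυ
  have hυ0 : υ ≠ 0 := hne0 hυ
  have : NormedSpace.exp (padicLog p υ) * υ⁻¹ = 1 := hR
  calc NormedSpace.exp (padicLog p υ) = (NormedSpace.exp (padicLog p υ) * υ⁻¹) * υ := by
        field_simp
    _ = υ := by rw [this, one_mul]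

/-! ### `cosh (log_p υ) = (υ + υ⁻¹)/2` -/

/-- **`coshOfSq ((log_p υ)²) = (υ + υ⁻¹)/2` for one-units `υ` (`‖υ − 1‖ ≤ p⁻¹`, `p ≠ 2`)**:
`Σ_n L^{2n}/(2n)! = (exp_p L + exp_p(−L))/2` (even/odd splitting of the exponential series,
Mathlib `HasSum.even_add_odd`) with `L = log_p υ`, `exp_p L = υ`, `exp_p(−L) = exp_p(log_p υ⁻¹) = υ⁻¹`
(Prop. 5.7.8). This is the identity behind SW's "`(u−1)²/u = u + u⁻¹ − 2`" transcription of
`σ_p(u)` through `cosh(log_p u)`. [Gouvêa 1993, Prop. 5.7.8; Stein–Wuthrich 2013, §4.2]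
[cite: Gouvea1993PadicNumbers, §5.7 Prop. 5.7.8 (PDF p. 124)] [cite: SteinWuthrich2013, §4.2 (p. 15)] -/
theorem coshOfSq_padicLog_sq (hp2 : p ≠ 2) {υ : ℚ_[p]} (hυ : ‖υ - 1‖ ≤ (p : ℝ)⁻¹) :
    coshOfSq (padicLog p υ ^ 2) = (υ + υ⁻¹) / 2 := by
  have hυ1 : ‖υ‖ = 1 := norm_eq_one_of_norm_sub_one_le hυ
  have hυ0 : υ ≠ 0 := by intro h0; rw [h0, norm_zero] at hυ1; exact zero_ne_one hυ1
  set L := padicLog p υ with hLdef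
  have hL : ‖L‖ ≤ (p : ℝ)⁻¹ := norm_padicLog_le_inv hp2 υ
  have hnL : ‖-L‖ ≤ (p : ℝ)⁻¹ := by rw [norm_neg]; exact hL
  -- `exp L = υ`, `exp (−L) = υ⁻¹`
  have hEL : NormedSpace.exp L = υ := exp_padicLog_eq_self hp2 hυ
  have hinv1 : ‖υ⁻¹ - 1‖ ≤ (p : ℝ)⁻¹ := by
    have e : υ⁻¹ - 1 = -(υ⁻¹ * (υ - 1)) := by field_simp; ring
    rw [e, norm_neg, norm_mul, norm_inv, hυ1, inv_one, one_mul]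
    exact hυ
  have hLinv : padicLog p υ⁻¹ = -L := by
    have h := padicLog_mul_holds p hυ0 (inv_ne_zero hυ0)
    rw [mul_inv_cancel₀ hυ0] at h
    have h1 : padicLog p (1 : ℚ_[p]) = 0 := by
      have h11 := padicLog_mul_holds p (x := 1) (y := 1) one_ne_zero one_ne_zero
      rw [mul_one] at h11; linear_combination -h11
    rw [h1] at h
    linear_combination -h
  have hEnL : NormedSpace.exp (-L) = υ⁻¹ := by
    rw [← hLinv]; exact exp_padicLog_eq_self hp2 hinv1
  -- even/odd splitting
  have hsumL := hasSum_exp_of_norm_le hp2 hL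
  have hsumnL := hasSum_exp_of_norm_le hp2 hnL
  have hsum : HasSum (fun n : ℕ => ((n ! : ℕ) : ℚ_[p])⁻¹ * (L ^ n + (-L) ^ n)) (υ + υ⁻¹) := by
    have e : υ + υ⁻¹ = NormedSpace.exp L + NormedSpace.exp (-L) := by rw [hEL, hEnL]
    have hfun : (fun n : ℕ => ((n ! : ℕ) : ℚ_[p])⁻¹ * (L ^ n + (-L) ^ n)) =
        fun n : ℕ => ((n ! : ℕ) : ℚ_[p])⁻¹ * L ^ n + ((n ! : ℕ) : ℚ_[p])⁻¹ * (-L) ^ n := by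
      funext n; ring
    rw [e, hfun]
    exact hsumL.add hsumnL
  -- the even part
  have heven : HasSum (fun k : ℕ => (((2 * k) ! : ℕ) : ℚ_[p])⁻¹ * (L ^ (2 * k) + (-L) ^ (2 * k)))
      (2 * coshOfSq (L ^ 2)) := by
    have h2 : Summable fun k : ℕ => ((((2 * k) ! : ℕ) : ℚ_[p])⁻¹ * L ^ (2 * k)) :=
      hsumL.summable.comp_injective (mul_right_injective₀ (two_ne_zero' ℕ))
    have hfun1 : (fun k : ℕ => (L ^ 2) ^ k / (((2 * k) ! : ℕ) : ℚ_[p])) =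
        fun k : ℕ => ((((2 * k) ! : ℕ) : ℚ_[p])⁻¹ * L ^ (2 * k)) := by
      funext k; rw [← pow_mul, div_eq_inv_mul]
    have hco : HasSum (fun k : ℕ => (L ^ 2) ^ k / (((2 * k) ! : ℕ) : ℚ_[p])) (coshOfSq (L ^ 2)) := by
      have hs : Summable fun k : ℕ => (L ^ 2) ^ k / (((2 * k) ! : ℕ) : ℚ_[p]) := by
        rw [hfun1]; exact h2
      unfold coshOfSq
      exact hs.hasSum
    have hfun2 : (fun k : ℕ => (((2 * k) ! : ℕ) : ℚ_[p])⁻¹ * (L ^ (2 * k) + (-L) ^ (2 * k))) =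
        fun k : ℕ => 2 * ((L ^ 2) ^ k / (((2 * k) ! : ℕ) : ℚ_[p])) := by
      funext k
      rw [Even.neg_pow (even_two_mul k), ← pow_mul, div_eq_inv_mul]
      ring
    rw [hfun2]
    exact hco.mul_left 2
  -- the odd part vanishes
  have hodd : HasSum (fun k : ℕ => (((2 * k + 1) ! : ℕ) : ℚ_[p])⁻¹ *
      (L ^ (2 * k + 1) + (-L) ^ (2 * k + 1))) 0 := by
    have hfun3 : (fun k : ℕ => (((2 * k + 1) ! : ℕ) : ℚ_[p])⁻¹ *
        (L ^ (2 * k + 1) + (-L) ^ (2 * k + 1))) = fun _ => 0 := by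
      funext k
      rw [Odd.neg_pow ⟨k, rfl⟩, add_neg_cancel, mul_zero]
    rw [hfun3]
    exact hasSum_zero
  have hall := HasSum.even_add_odd (f := fun n : ℕ => ((n ! : ℕ) : ℚ_[p])⁻¹ * (L ^ n + (-L) ^ n))
    heven hodd
  rw [add_zero] at hall
  have huniq := hsum.unique hall
  rw [huniq]
  field_simp

end Literature.NumberTheory.EllipticCurves.SteinWuthrich2013

end
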